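import Mathlib

/-!
# `SnSubsetDichotomy.HyperoctahedralThreshold`, line `refutation-local-symmetry` — stub `stub_packGadgets`

Greedy packing of local gadgets (crux `stmt-MatrixMultiplication-10883`, registered stub
`stub_packGadgets` of the lead's skeleton for line `refutation-local-symmetry`).

Hypothesis ("one gadget avoiding a small forbidden set"): there is `n₀` such that for `n ≥ n₀`,
any three fixed-point-free involutions `μ 0, μ 1, μ 2` of `Fin n` and any `R ⊆ Fin n` with
`|R| ≤ n ^ (3/4)` admit a commuting local triple — commuting involutions `a, b`, not both `1`,
with `a ∈ C(μ 0)`, `b ∈ C(μ 1)`, `a * b ∈ C(μ 2)` — whose support lies in a set `P` disjoint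
from `R` with `|P| ≤ 2 n ^ (1/4)`.

Conclusion: with `x := 1`, `c := 1/4` and the same `n₀`, for `n ≥ n₀` every such triple `μ`
carries `g ≥ c √n` commuting local triples with pairwise disjoint supports (the long-cycle
hypothesis of the conclusion is not used).

Proof.  Put `g := ⌈√n / 4⌉₊`.  A greedy induction (`PackGadgets.greedy_pack`) builds, for every
`m` with `(m - 1) · 2 n^{1/4} ≤ n^{3/4}`, a family of `m` gadgets with pairwise disjoint support
sets `P_i`, `|P_i| ≤ 2 n^{1/4}`: at the successor step the forbidden set is `R := ⋃ P_i`, of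
cardinality `≤ m · 2 n^{1/4} ≤ n^{3/4}`, and the new gadget (appended with `Fin.snoc`) has support
set disjoint from `R`, hence from every earlier `P_i`.  Since `g - 1 < √n / 4` we have
`(g - 1) · 2 n^{1/4} ≤ n^{1/2} · n^{1/4} / 2 ≤ n^{3/4}`, so the induction reaches `m = g`; finally
a point moved by gadget `j` lies in `P_j`, hence outside `P_{j'}` for `j' ≠ j`, hence is fixed by
gadget `j'`.
-/

-- the tree's namespace `Summit.MatrixMultiplication.MatrixMultiplication.…` repeats a component by design
set_option linter.dupNamespace false

namespace Summit.MatrixMultiplication.MatrixMultiplication.Theorems.HyperoctahedralThreshold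

open Equiv

namespace PackGadgets

/-- Abstract greedy packing: if every forbidden set of size `≤ B` is avoided by the support of some
good object whose support has size `≤ K`, then for `(m - 1) K ≤ B` there are `m` good objects with
pairwise disjoint supports (each of size `≤ K`). [folklore] -/
theorem greedy_pack {α X : Type*} [DecidableEq X] (good : α → Prop) (supp : α → Finset X)
    {B K : ℝ} (hK : 0 ≤ K)
    (h : ∀ R : Finset X, (R.card : ℝ) ≤ B →
      ∃ t, good t ∧ Disjoint (supp t) R ∧ ((supp t).card : ℝ) ≤ K) :
    ∀ m : ℕ, ((m : ℝ) - 1) * K ≤ B →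
      ∃ F : Fin m → α, (∀ i, good (F i)) ∧ (∀ i, ((supp (F i)).card : ℝ) ≤ K) ∧
        (∀ i i', i ≠ i' → Disjoint (supp (F i)) (supp (F i'))) := by
  intro m
  induction m with
  | zero =>
    exact fun _ => ⟨fun i => i.elim0, fun i => i.elim0, fun i => i.elim0, fun i => i.elim0⟩
  | succ m ih =>
    intro hm
    have hmK : (m : ℝ) * K ≤ B := by
      have e : ((m + 1 : ℕ) : ℝ) - 1 = m := by push_cast; ring
      rwa [e] at hm
    obtain ⟨F, hgood, hcard, hdisj⟩ :=
      ih ((mul_le_mul_of_nonneg_right (by linarith) hK).trans hmK)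
    -- the forbidden set: the union of the supports found so far
    have hR : (((Finset.univ.biUnion fun i => supp (F i)).card : ℕ) : ℝ) ≤ B := by
      calc (((Finset.univ.biUnion fun i => supp (F i)).card : ℕ) : ℝ)
          ≤ ∑ i, ((supp (F i)).card : ℝ) := by exact_mod_cast Finset.card_biUnion_le
        _ ≤ ∑ _i : Fin m, K := Finset.sum_le_sum fun i _ => hcard i
        _ = m * K := by simp
        _ ≤ B := hmK
    obtain ⟨t, ht, htR, htK⟩ := h _ hR
    rw [Finset.disjoint_biUnion_right] at htR
    refine ⟨Fin.snoc F t, fun i => ?_, fun i => ?_, fun i i' hii' => ?_⟩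
    · obtain ⟨j, rfl⟩ | rfl := Fin.eq_castSucc_or_eq_last i
      · simpa only [Fin.snoc_castSucc] using hgood j
      · simpa only [Fin.snoc_last] using ht
    · obtain ⟨j, rfl⟩ | rfl := Fin.eq_castSucc_or_eq_last i
      · simpa only [Fin.snoc_castSucc] using hcard j
      · simpa only [Fin.snoc_last] using htK
    · obtain ⟨j, rfl⟩ | rfl := Fin.eq_castSucc_or_eq_last i <;>
        obtain ⟨j', rfl⟩ | rfl := Fin.eq_castSucc_or_eq_last i'
      · simp only [Fin.snoc_castSucc]
        exact hdisj j j' fun e => hii' (by rw [e])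
      · simp only [Fin.snoc_castSucc, Fin.snoc_last]
        exact (htR j (Finset.mem_univ j)).symm
      · simp only [Fin.snoc_castSucc, Fin.snoc_last]
        exact htR j' (Finset.mem_univ j')
      · exact absurd rfl hii'

/-- The cardinality bookkeeping of the greedy step: `(⌈√n / 4⌉₊ - 1) · 2 n^{1/4} ≤ n^{3/4}`.
[folklore] -/
theorem ceil_sub_one_mul_le (n : ℕ) :
    ((⌈Real.sqrt n / 4⌉₊ : ℝ) - 1) * (2 * (n : ℝ) ^ ((1 : ℝ) / 4)) ≤ (n : ℝ) ^ ((3 : ℝ) / 4) := by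
  have hn : (0 : ℝ) ≤ n := Nat.cast_nonneg n
  have hs : 0 ≤ Real.sqrt n / 4 := by positivity
  have h1 : (⌈Real.sqrt n / 4⌉₊ : ℝ) - 1 ≤ Real.sqrt n / 4 := by
    have := Nat.ceil_lt_add_one hs
    linarith
  have hq : 0 ≤ (n : ℝ) ^ ((1 : ℝ) / 4) := Real.rpow_nonneg hn _
  have h34 : (n : ℝ) ^ ((3 : ℝ) / 4) = Real.sqrt n * (n : ℝ) ^ ((1 : ℝ) / 4) := by
    rw [Real.sqrt_eq_rpow, ← Real.rpow_add' hn (by norm_num)]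
    norm_num
  have hp : 0 ≤ Real.sqrt n * (n : ℝ) ^ ((1 : ℝ) / 4) := mul_nonneg (Real.sqrt_nonneg _) hq
  calc ((⌈Real.sqrt n / 4⌉₊ : ℝ) - 1) * (2 * (n : ℝ) ^ ((1 : ℝ) / 4))
      ≤ (Real.sqrt n / 4) * (2 * (n : ℝ) ^ ((1 : ℝ) / 4)) :=
        mul_le_mul_of_nonneg_right h1 (mul_nonneg zero_le_two hq)
    _ = (Real.sqrt n * (n : ℝ) ^ ((1 : ℝ) / 4)) / 2 := by ring
    _ ≤ Real.sqrt n * (n : ℝ) ^ ((1 : ℝ) / 4) := by linarith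
    _ = (n : ℝ) ^ ((3 : ℝ) / 4) := h34.symm

/-- The count of gadgets: `√n / 4 ≤ ⌈√n / 4⌉₊`. [folklore] -/
theorem quarter_mul_sqrt_le_ceil (n : ℕ) :
    (1 / 4 : ℝ) * Real.sqrt n ≤ (⌈Real.sqrt n / 4⌉₊ : ℝ) := by
  have := Nat.le_ceil (Real.sqrt n / 4)
  linarith

end PackGadgets

/-- **Greedy packing of gadgets** (stub `stub_packGadgets` of line `refutation-local-symmetry`):
if for `n ≥ n₀` every fixed-point-free involution triple admits, away from any forbidden set of
size `≤ n^{3/4}`, a commuting local triple supported on `≤ 2 n^{1/4}` points, then for `n ≥ n₀`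
every such triple carries `≥ √n / 4` commuting local triples with pairwise disjoint supports.
[folklore] -/
theorem stub_packGadgets : (∃ n₀ : ℕ, ∀ n ≥ n₀, ∀ μ : Fin 3 → Equiv.Perm (Fin n), (∀ i, μ i * μ i = 1 ∧ ∀ v, μ i v ≠ v) → ∀ R : Finset (Fin n), (R.card : ℝ) ≤ (n : ℝ) ^ ((3 : ℝ) / 4) → ∃ (a b : Equiv.Perm (Fin n)) (P : Finset (Fin n)), (a * a = 1 ∧ b * b = 1 ∧ a * b = b * a ∧ (a ≠ 1 ∨ b ≠ 1) ∧ a * μ 0 = μ 0 * a ∧ b * μ 1 = μ 1 * b ∧ a * b * μ 2 = μ 2 * (a * b) ∧ ∀ v, (a v ≠ v ∨ b v ≠ v) → v ∈ P) ∧ Disjoint P R ∧ (P.card : ℝ) ≤ 2 * (n : ℝ) ^ ((1 : ℝ) / 4)) → (∃ x : ℝ, 0 < x ∧ ∃ c : ℝ, 0 < c ∧ ∃ n₀ : ℕ, ∀ n ≥ n₀, ∀ μ : Fin 3 → Equiv.Perm (Fin n), (∀ i, μ i * μ i = 1 ∧ ∀ v, μ i v ≠ v) → (∀ i j : Fin 3,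 i ≠ j → ∃ k ∈ (μ i * μ j).cycleType, x * Real.sqrt (n : ℝ) ≤ (k : ℝ)) → ∃ (g : ℕ) (a b : Fin g → Equiv.Perm (Fin n)), c * Real.sqrt (n : ℝ) ≤ (g : ℝ) ∧ (∀ j, a j * a j = 1 ∧ b j * b j = 1 ∧ a j * b j = b j * a j ∧ (a j ≠ 1 ∨ b j ≠ 1) ∧ a j * μ 0 = μ 0 * a j ∧ b j * μ 1 = μ 1 * b j ∧ a j * b j * μ 2 = μ 2 * (a j * b j)) ∧ (∀ j j' : Fin g, j ≠ j' → ∀ v, (a j v ≠ v ∨ b j v ≠ v) → a j' v = v ∧ b j' v = v)) := by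
  rintro ⟨n₀, hG⟩
  refine ⟨1, one_pos, 1 / 4, by norm_num, n₀, ?_⟩
  intro n hn μ hμ _hlong
  -- greedy packing of `⌈√n / 4⌉₊` gadgets `(a, b, P)` with pairwise disjoint support sets `P`
  obtain ⟨F, hgood, -, hdisj⟩ := PackGadgets.greedy_pack
    (fun t : Perm (Fin n) × Perm (Fin n) × Finset (Fin n) =>
      t.1 * t.1 = 1 ∧ t.2.1 * t.2.1 = 1 ∧ t.1 * t.2.1 = t.2.1 * t.1 ∧ (t.1 ≠ 1 ∨ t.2.1 ≠ 1) ∧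
        t.1 * μ 0 = μ 0 * t.1 ∧ t.2.1 * μ 1 = μ 1 * t.2.1 ∧
        t.1 * t.2.1 * μ 2 = μ 2 * (t.1 * t.2.1) ∧ ∀ v, (t.1 v ≠ v ∨ t.2.1 v ≠ v) → v ∈ t.2.2)
    (fun t => t.2.2) (mul_nonneg zero_le_two (Real.rpow_nonneg (Nat.cast_nonneg n) _))
    (fun R hR => by
      obtain ⟨a, b, P, h1, h2, h3⟩ := hG n hn μ hμ R hR
      exact ⟨(a, b, P), h1, h2, h3⟩)
    ⌈Real.sqrt n / 4⌉₊ (PackGadgets.ceil_sub_one_mul_le n)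
  refine ⟨⌈Real.sqrt n / 4⌉₊, fun j => (F j).1, fun j => (F j).2.1,
    PackGadgets.quarter_mul_sqrt_le_ceil n, fun j => ?_, fun j j' hjj' v hv => ?_⟩
  · obtain ⟨h1, h2, h3, h4, h5, h6, h7, -⟩ := hgood j
    exact ⟨h1, h2, h3, h4, h5, h6, h7⟩
  · -- `v` is moved by gadget `j`, so `v ∈ P j`, so `v ∉ P j'`, so gadget `j'` fixes `v`
    have hvj : v ∈ (F j).2.2 := (hgood j).2.2.2.2.2.2.2 v hv
    have hvj' : v ∉ (F j').2.2 := Finset.disjoint_left.1 (hdisj j j' hjj') hvj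
    by_contra hcon
    exact hvj' ((hgood j').2.2.2.2.2.2.2 v (not_and_or.1 hcon))

end Summit.MatrixMultiplication.MatrixMultiplication.Theorems.HyperoctahedralThreshold
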